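import Summits.CriticalPhenomena.PercolationContinuityZ3.Theorems.Transplant.AutEndStateTypesDefs
import Summits.CriticalPhenomena.PercolationContinuityZ3.Theorems.Transplant.AutEndStateCayley
import Mathlib.GroupTheory.Index
import HarnessLib

/-!
# THE END-STATE NODE CANNOT BE BOUNDED IN THE NUMBER OF TYPES: in `Γ_p = ℤ^p ⋊ C_p` every subgroup carrying a `ℤ²`-character of rank two lies in
# the lattice `ℤ^p` (index a multiple of `p`); on a GRR of `Γ_p` every end-state datum has at least `p` vertex orbits; `p` orbits suffice

builds on p205010 (kernel theorem, internal audit signed; external expert review pending) — nothing in this file uses p205010; UNCONDITIONAL (pure group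
theory + the tree's Cayley-graph input theorem); nothing is claimed about any open node.  Lane `prim-bschramm`, seat `prim-bschramm-p4` gen 28 (PART C3 of
`P4-GENERAL.md` §50).  Helper file (`--supports stmt-CriticalPhenomena-4575 --as helper`); def-free (the objects are in `AutEndStateTypesDefs`).

THE QUESTION (class map §D, "numbers that matter for planning").  After gen 27 the polynomial-growth residual of Conjecture 4 for this method is ONE node:
END-STATE CONTINUITY — `θ(p_c) = 0` on graphs with a subgroup `A₀ ≤ Aut(G)` having FINITELY MANY orbits ("types") and a rank-two `ℤ²`-character killing
every stabiliser.  The one-type node `U_s` is the case of ONE orbit; the wall examples on record need a handful (`ℤ² ⋊ C₄`-type alphabets: four).  Could a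
node for a BOUNDED number of types — two, four, twelve (the order of the largest finite subgroup of `GL₂(ℤ)`) — already cover polynomial growth?  NO:
* **`ZWr.le_ker_of_rankTwo`** — for every prime `p`, every subgroup `A₀ ≤ Γ_p = ℤ^p ⋊ C_p` (cyclic coordinate shift) with a homomorphism `A₀ → ℤ²` of
  rank-two image lies in the lattice `ℤ^p = ker(Γ_p → C_p)`.  PROOF (averaging): if `a ∈ A₀` rotates by `g ≠ 0`, its powers rotate by every `h ∈ ℤ/p`
  (`p` prime), so the lattice `L = {v : inl v ∈ A₀}` is shift-stable and the inherited character `ψ : L → ℤ²` is shift-INVARIANT (`c(a x a⁻¹) = c(x)`);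
  then `p·ψ(v) = ψ(Σ_h shift_h v) = ψ((Σᵢ vᵢ)·𝟙)`-type identities make all values of `ψ` proportional (`det2_charOf_eq_zero`), and `x^p ∈ L` for every
  `x ∈ A₀` makes all values of `c` proportional — contradicting rank two.
* **`ZWr.dvd_index` / `ZWr.le_index`**: hence `p ∣ [Γ_p : A₀]` (`index = 0`, i.e. infinite index, allowed) and `p ≤ [Γ_p : A₀]` when the index is finite —
  the number of orbits of ANY end-state-type subgroup of `Γ_p` acting on `Γ_p` is at least `p`.
* **`ZWr.le_card_reps_of_grr`** (graph level): on a Cayley graph `Cay(Γ_p; S)` all of whose automorphisms are left translations (a GRR — such `S` exist for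
  every `Γ_p`, Leemann–de la Salle 2022 Cor. 1.2, R-level, not used), EVERY end-state datum `(A ≤ Aut, reps, c)` has `p ≤ |reps|`: at least `p` types.
* **Sharpness / the input exists** (`ZWr.exists_rankTwo_ker`, `ZWr.index_ker`, `ZWr.exists_endState_input`): the lattice itself (index EXACTLY `p`) carries
  the rank-two character `v ↦ (v₀, v₁)` (`p ≥ 2`), so by gen 27's `EndStateCayley.exists_input_of_vb1` EVERY Cayley graph of `Γ_p` carries an end-state
  datum with `p` orbit representatives: `Γ_p` (virtually `ℤ^p` — polynomial growth of degree `p`, `p_c < 1`; `b₁(Γ_p) = 1 < 2 ≤ vb₁(Γ_p)`: a wall group in the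
  sense of P4 §48; these three facts are context, not used) has Cayley graphs in the end-state class which — on a GRR — need EXACTLY `p` types.  Since `p` is
  any prime, **no node quantifying over a
  bounded number of types contains all Cayley graphs of polynomial growth**: the end-state node must be uniform in the number of types (and the finite
  subgroups of `GL₂(ℤ)` do not bound it — the twist here lives in `GL_p(ℤ)`).
[cite: BenjaminiSchramm1996, Conj. 4; §2 (Cayley graphs; almost transitive graphs)] [cite: LeemannDelasalle2022, Cor. 1.2] [cite: GrimmettLi2017Amenability, Prop. 18]
[cite: KozmaNitzan2024, §4 p. 16 (Lemma 8: the role of the lattice symmetries)]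
-/

noncomputable section

namespace Summit.CriticalPhenomena.PercolationContinuityZ3.Theorems.Transplant

open SimpleGraph Literature.Probability.LatticeModels
open scoped Classical

namespace ZWr

variable {p : ℕ}

/-! ## §1 Arithmetic: determinants of proportional vectors; sums over all shifts; powers of a non-zero rotation -/

/-- `det(u, k•v) = k·det(u, v)`. [folklore] -/
theorem det2_smul_right (k : ℤ) (u v : Site 2) : MaxArea.det2 u (k • v) = k * MaxArea.det2 u v := by
  unfold MaxArea.det2; simp only [Pi.smul_apply, smul_eq_mul]; ring

/-- `det(k•u, v) = k·det(u, v)`. [folklore] -/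
theorem det2_smul_left (k : ℤ) (u v : Site 2) : MaxArea.det2 (k • u) v = k * MaxArea.det2 u v := by
  unfold MaxArea.det2; simp only [Pi.smul_apply, smul_eq_mul]; ring

/-- Two vectors with a non-trivial proportionality `a•v = b•u`, `a ≠ 0`, have `det = 0`. [folklore] -/
theorem det2_eq_zero_of_smul_eq_smul {a b : ℤ} {u v : Site 2} (ha : a ≠ 0) (h : a • v = b • u) : MaxArea.det2 u v = 0 := by
  have h1 : a * MaxArea.det2 u v = 0 := by rw [← det2_smul_right, h, det2_smul_right, MaxArea.det2_self, mul_zero]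
  exact (mul_eq_zero.1 h1).resolve_left ha

/-- **Summing a vector over all its cyclic shifts gives a constant vector** (`Σ_h v(i − h) = Σ_k v(k)`). [folklore] -/
theorem sum_shift [NeZero p] (v : ZMod p → ℤ) (i : ZMod p) : ∑ h : ZMod p, v (i - h) = ∑ k : ZMod p, v k :=
  (Equiv.subLeft i).sum_comp v

/-- In `ℤ/p`, `p` prime, every element is a multiple of any non-zero element. [folklore] -/
theorem exists_nsmul_eq [Fact p.Prime] {g : ZMod p} (hg : g ≠ 0) (h : ZMod p) : ∃ j : ℕ, j • g = h :=
  ⟨(h * g⁻¹).val, by rw [nsmul_eq_mul, ZMod.natCast_zmod_val, inv_mul_cancel_right₀ hg]⟩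

/-- A `p`-th power has trivial rotation part. [folklore] -/
theorem right_pow_card [NeZero p] (x : Grp p) : (x ^ p).right = 1 := by
  have hc : Fintype.card (Rot p) = p := by rw [Fintype.card_multiplicative, ZMod.card]
  have h : (SemidirectProduct.rightHom x) ^ Fintype.card (Rot p) = 1 := pow_card_eq_one
  rw [hc, ← map_pow] at h
  exact h

/-! ## §2 The lattice of `A₀` is stable under the rotations present in `A₀`, and the inherited character is invariant -/

variable (A₀ : Subgroup (Grp p)) (c : A₀ →* Multiplicative (Site 2))

/-- The shifted vector `v(· − g)`, as an element of `ℤ^p` written multiplicatively, is the shift of `v`. [folklore] -/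
theorem ofAdd_shift_eq (g : Rot p) (v : ZMod p → ℤ) :
    Multiplicative.ofAdd (fun i => v (i - Multiplicative.toAdd g)) = shiftHom p g (Multiplicative.ofAdd v) := rfl

/-- **Conjugation by `a ∈ A₀` keeps the lattice of `A₀` and shifts it by the rotation part of `a`.** [folklore] -/
theorem shift_mem_of_mem (a : A₀) {v : ZMod p → ℤ} (hv : v ∈ latticeOf A₀) :
    (fun i => v (i - Multiplicative.toAdd (a : Grp p).right)) ∈ latticeOf A₀ := by
  rw [mem_latticeOf, ofAdd_shift_eq, ← conj_inl]
  exact A₀.mul_mem (A₀.mul_mem a.2 hv) (A₀.inv_mem a.2)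

/-- **The inherited character is invariant under the rotations present in `A₀`** (`c(a x a⁻¹) = c(x)` in the abelian group `ℤ²`). [folklore] -/
theorem charOf_shift_of_mem (a : A₀) (v : latticeOf A₀) :
    charOf A₀ c ⟨_, shift_mem_of_mem A₀ a v.2⟩ = charOf A₀ c v := by
  rw [charOf_apply, charOf_apply]
  have hx : (⟨SemidirectProduct.inl (Multiplicative.ofAdd fun i => (v : ZMod p → ℤ) (i - Multiplicative.toAdd (a : Grp p).right)),
      inl_ofAdd_mem (⟨_, shift_mem_of_mem A₀ a v.2⟩ : latticeOf A₀)⟩ : A₀) =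
        a * ⟨SemidirectProduct.inl (Multiplicative.ofAdd (v : ZMod p → ℤ)), inl_ofAdd_mem v⟩ * a⁻¹ :=
    Subtype.ext (by
      show SemidirectProduct.inl (Multiplicative.ofAdd fun i => (v : ZMod p → ℤ) (i - Multiplicative.toAdd (a : Grp p).right)) =
        (a : Grp p) * SemidirectProduct.inl (Multiplicative.ofAdd (v : ZMod p → ℤ)) * (a : Grp p)⁻¹
      rw [conj_inl]; rfl)
  have hc : c ⟨SemidirectProduct.inl (Multiplicative.ofAdd fun i => (v : ZMod p → ℤ) (i - Multiplicative.toAdd (a : Grp p).right)),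
      inl_ofAdd_mem (⟨_, shift_mem_of_mem A₀ a v.2⟩ : latticeOf A₀)⟩ =
        c ⟨SemidirectProduct.inl (Multiplicative.ofAdd (v : ZMod p → ℤ)), inl_ofAdd_mem v⟩ := by
    rw [hx, map_mul, map_mul, map_inv, mul_inv_cancel_comm]
  exact congrArg Multiplicative.toAdd hc

/-- With a rotation by `g ≠ 0` in `A₀` (`p` prime), the lattice of `A₀` is stable under EVERY shift … [folklore] -/
theorem shift_mem [Fact p.Prime] (a : A₀) (ha : (a : Grp p).right ≠ 1) {v : ZMod p → ℤ} (hv : v ∈ latticeOf A₀) (h : ZMod p) :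
    (fun i => v (i - h)) ∈ latticeOf A₀ := by
  have hg : Multiplicative.toAdd (a : Grp p).right ≠ 0 := fun h0 => ha (by rw [← ofAdd_toAdd (a : Grp p).right, h0, ofAdd_zero])
  obtain ⟨j, hj⟩ := exists_nsmul_eq hg h
  have hmem := shift_mem_of_mem A₀ (a ^ j) hv
  have hr : Multiplicative.toAdd ((a ^ j : A₀) : Grp p).right = h := by
    rw [Subgroup.coe_pow, ← SemidirectProduct.rightHom_eq_right, map_pow, toAdd_pow, SemidirectProduct.rightHom_eq_right, hj]
  rwa [hr] at hmem

/-- … and the inherited character is invariant under EVERY shift. [folklore] -/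
theorem charOf_shift [Fact p.Prime] (a : A₀) (ha : (a : Grp p).right ≠ 1) (v : latticeOf A₀) (h : ZMod p) :
    charOf A₀ c ⟨_, shift_mem A₀ a ha v.2 h⟩ = charOf A₀ c v := by
  have hg : Multiplicative.toAdd (a : Grp p).right ≠ 0 := fun h0 => ha (by rw [← ofAdd_toAdd (a : Grp p).right, h0, ofAdd_zero])
  obtain ⟨j, hj⟩ := exists_nsmul_eq hg h
  have hr : Multiplicative.toAdd ((a ^ j : A₀) : Grp p).right = h := by
    rw [Subgroup.coe_pow, ← SemidirectProduct.rightHom_eq_right, map_pow, toAdd_pow, SemidirectProduct.rightHom_eq_right, hj]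
  have key := charOf_shift_of_mem A₀ c (a ^ j) v
  have e : (⟨_, shift_mem_of_mem A₀ (a ^ j) v.2⟩ : latticeOf A₀) = ⟨_, shift_mem A₀ a ha v.2 h⟩ := Subtype.ext (by simp only [hr])
  rwa [e] at key

/-! ## §3 Averaging over `C_p`: a shift-invariant character on a shift-stable lattice has rank at most one -/

/-- **The averaged vector `Σ_h shift_h v` lies in the lattice and is the constant vector `(Σᵢ vᵢ)·𝟙`; the character takes the value `p·ψ(v)` on it.**
[folklore] -/
theorem charOf_sum_shift [Fact p.Prime] (a : A₀) (ha : (a : Grp p).right ≠ 1) (v : latticeOf A₀) :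
    ∃ hS : (fun _ : ZMod p => ∑ k : ZMod p, (v : ZMod p → ℤ) k) ∈ latticeOf A₀,
      charOf A₀ c ⟨_, hS⟩ = (p : ℤ) • charOf A₀ c v := by
  haveI : NeZero p := ⟨(Fact.out : p.Prime).ne_zero⟩
  set w : ZMod p → latticeOf A₀ := fun h => ⟨fun i => (v : ZMod p → ℤ) (i - h), shift_mem A₀ a ha v.2 h⟩ with hw
  have hsum : ((∑ h : ZMod p, w h : latticeOf A₀) : ZMod p → ℤ) = fun _ => ∑ k : ZMod p, (v : ZMod p → ℤ) k := by
    rw [AddSubgroup.val_finsetSum]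
    funext i
    rw [Finset.sum_apply]
    exact sum_shift (v : ZMod p → ℤ) i
  have hS : (fun _ : ZMod p => ∑ k : ZMod p, (v : ZMod p → ℤ) k) ∈ latticeOf A₀ := by rw [← hsum]; exact (∑ h : ZMod p, w h).2
  refine ⟨hS, ?_⟩
  have e : (⟨_, hS⟩ : latticeOf A₀) = ∑ h : ZMod p, w h := Subtype.ext hsum.symm
  rw [e, map_sum]
  have hc : ∀ h : ZMod p, charOf A₀ c (w h) = charOf A₀ c v := fun h => charOf_shift A₀ c a ha v h
  simp only [hc, Finset.sum_const, Finset.card_univ, ZMod.card, natCast_zsmul]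

/-- **All values of the inherited character are proportional** (given a rotation by `g ≠ 0` in `A₀`). [folklore] -/
theorem det2_charOf_eq_zero [Fact p.Prime] (a : A₀) (ha : (a : Grp p).right ≠ 1) (v w : latticeOf A₀) :
    MaxArea.det2 (charOf A₀ c v) (charOf A₀ c w) = 0 := by
  have hp : (p : ℤ) ≠ 0 := by exact_mod_cast (Fact.out : p.Prime).ne_zero
  obtain ⟨hSv, hv⟩ := charOf_sum_shift A₀ c a ha v
  obtain ⟨hSw, hw⟩ := charOf_sum_shift A₀ c a ha w
  set sv : ℤ := ∑ k : ZMod p, (v : ZMod p → ℤ) k with hsv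
  set sw : ℤ := ∑ k : ZMod p, (w : ZMod p → ℤ) k with hsw
  -- the two averaged vectors are proportional: `sw • S v = sv • S w`
  have hprop : sw • (⟨_, hSv⟩ : latticeOf A₀) = sv • (⟨_, hSw⟩ : latticeOf A₀) := by
    apply Subtype.ext
    simp only [AddSubgroup.coe_zsmul]
    funext i
    simp only [Pi.smul_apply, smul_eq_mul]
    ring
  have key : sw • ((p : ℤ) • charOf A₀ c v) = sv • ((p : ℤ) • charOf A₀ c w) := by
    rw [← hv, ← hw, ← map_zsmul, ← map_zsmul, hprop]
  by_cases hs : sv = 0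
  · -- then `S v = 0`, so `p • ψ v = 0`, so `ψ v = 0`
    have h0 : (⟨_, hSv⟩ : latticeOf A₀) = 0 := by
      apply Subtype.ext
      funext i
      show (∑ k : ZMod p, (v : ZMod p → ℤ) k) = 0
      exact hs
    rw [h0, map_zero] at hv
    have hv0 : charOf A₀ c v = 0 := by
      rcases smul_eq_zero.1 hv.symm with h | h
      · exact absurd h hp
      · exact h
    rw [hv0, MaxArea.det2_zero_left]
  · rw [smul_smul, smul_smul] at key
    exact det2_eq_zero_of_smul_eq_smul (mul_ne_zero hs hp) key.symm

/-! ## §4 THE THEOREM: a subgroup of `Γ_p` with a rank-two `ℤ²`-character lies in the lattice; its index is a multiple of `p` -/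

/-- **THEOREM.**  For `p` prime, every subgroup `A₀ ≤ Γ_p = ℤ^p ⋊ C_p` carrying a homomorphism `c : A₀ → ℤ²` of rank-two image lies inside the lattice
`ℤ^p = ker(Γ_p → C_p)`. [cite: BenjaminiSchramm1996, §2 (almost transitive graphs)] -/
theorem le_ker_of_rankTwo [Fact p.Prime] (hrank : ∃ x y : A₀, MaxArea.det2 (Multiplicative.toAdd (c x)) (Multiplicative.toAdd (c y)) ≠ 0) :
    A₀ ≤ (SemidirectProduct.rightHom : Grp p →* Rot p).ker := by
  haveI : NeZero p := ⟨(Fact.out : p.Prime).ne_zero⟩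
  have hp : (p : ℤ) ≠ 0 := by exact_mod_cast (Fact.out : p.Prime).ne_zero
  by_contra hle
  obtain ⟨a₀, ha₀A, ha₀⟩ := (SetLike.not_le_iff_exists).1 hle
  rw [MonoidHom.mem_ker, SemidirectProduct.rightHom_eq_right] at ha₀
  set a : A₀ := ⟨a₀, ha₀A⟩ with ha
  have ha' : (a : Grp p).right ≠ 1 := ha₀
  -- every `x ∈ A₀` has `x^p` in the lattice, with character value `p • c(x)`
  have hpow : ∀ x : A₀, ∃ v : latticeOf A₀, charOf A₀ c v = (p : ℤ) • Multiplicative.toAdd (c x) := by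
    intro x
    have hr : ((x ^ p : A₀) : Grp p).right = 1 := by rw [Subgroup.coe_pow]; exact right_pow_card _
    have hmem : Multiplicative.toAdd ((x ^ p : A₀) : Grp p).left ∈ latticeOf A₀ := by
      rw [mem_latticeOf, ofAdd_toAdd, ← eq_inl_of_right_eq_one hr]
      exact (x ^ p).2
    refine ⟨⟨_, hmem⟩, ?_⟩
    rw [charOf_apply]
    have e : (⟨SemidirectProduct.inl (Multiplicative.ofAdd (Multiplicative.toAdd ((x ^ p : A₀) : Grp p).left)),
        inl_ofAdd_mem (⟨_, hmem⟩ : latticeOf A₀)⟩ : A₀) = x ^ p :=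
      Subtype.ext (by
        show SemidirectProduct.inl (Multiplicative.ofAdd (Multiplicative.toAdd ((x ^ p : A₀) : Grp p).left)) = ((x ^ p : A₀) : Grp p)
        rw [ofAdd_toAdd]; exact (eq_inl_of_right_eq_one hr).symm)
    rw [e, map_pow, toAdd_pow, natCast_zsmul]
  obtain ⟨x, y, hxy⟩ := hrank
  obtain ⟨vx, hvx⟩ := hpow x
  obtain ⟨vy, hvy⟩ := hpow y
  have h0 := det2_charOf_eq_zero A₀ c a ha' vx vy
  rw [hvx, hvy, det2_smul_left, det2_smul_right] at h0
  exact hxy ((mul_eq_zero.1 ((mul_eq_zero.1 h0).resolve_left hp)).resolve_left hp)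

/-- **COROLLARY: `p ∣ [Γ_p : A₀]`** (Mathlib convention: index `0` = infinite index, also a multiple of `p`). [cite: BenjaminiSchramm1996, §2] -/
theorem dvd_index [Fact p.Prime] (hrank : ∃ x y : A₀, MaxArea.det2 (Multiplicative.toAdd (c x)) (Multiplicative.toAdd (c y)) ≠ 0) :
    p ∣ A₀.index := by
  haveI : NeZero p := ⟨(Fact.out : p.Prime).ne_zero⟩
  have h := Subgroup.index_dvd_of_le (le_ker_of_rankTwo A₀ c hrank)
  have hk : (SemidirectProduct.rightHom : Grp p →* Rot p).ker.index = p := by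
    rw [Subgroup.index_ker, MonoidHom.range_eq_top_of_surjective _ SemidirectProduct.rightHom_surjective, Subgroup.card_top,
      Nat.card_eq_fintype_card, Fintype.card_multiplicative, ZMod.card]
  rwa [hk] at h

/-- **COROLLARY: a subgroup of FINITE index with a rank-two `ℤ²`-character has index `≥ p`** — it has at least `p` orbits on `Γ_p`.
[cite: BenjaminiSchramm1996, §2 (almost transitive graphs)] -/
theorem le_index [Fact p.Prime] [A₀.FiniteIndex]
    (hrank : ∃ x y : A₀, MaxArea.det2 (Multiplicative.toAdd (c x)) (Multiplicative.toAdd (c y)) ≠ 0) : p ≤ A₀.index :=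
  Nat.le_of_dvd (Nat.pos_of_ne_zero Subgroup.FiniteIndex.index_ne_zero) (dvd_index A₀ c hrank)

/-! ## §5 Sharpness: the lattice has index exactly `p` and carries a rank-two character; the end-state input on every Cayley graph of `Γ_p` -/

/-- The lattice `ker(Γ_p → C_p)` has index `p`. [folklore] -/
theorem index_ker [NeZero p] : (SemidirectProduct.rightHom : Grp p →* Rot p).ker.index = p := by
  rw [Subgroup.index_ker, MonoidHom.range_eq_top_of_surjective _ SemidirectProduct.rightHom_surjective, Subgroup.card_top,
    Nat.card_eq_fintype_card, Fintype.card_multiplicative, ZMod.card]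

/-- The coordinate characters of the lattice: `x ↦ x.left(i)` is a homomorphism on `ker(Γ_p → C_p)` (the rotation parts are trivial there). [folklore] -/
theorem exists_coord_hom (i : ZMod p) : ∃ ψ : (SemidirectProduct.rightHom : Grp p →* Rot p).ker →* Multiplicative ℤ,
    ∀ x, Multiplicative.toAdd (ψ x) = Multiplicative.toAdd (x : Grp p).left i := by
  refine ⟨{ toFun := fun x => Multiplicative.ofAdd (Multiplicative.toAdd (x : Grp p).left i)
            map_one' := by simp only [Subgroup.coe_one, SemidirectProduct.one_left, toAdd_one, Pi.zero_apply, ofAdd_zero]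
            map_mul' := fun x y => ?_ }, fun x => rfl⟩
  have hx : (x : Grp p).right = 1 := by
    have := x.2; rwa [MonoidHom.mem_ker, SemidirectProduct.rightHom_eq_right] at this
  rw [← ofAdd_add, Subgroup.coe_mul, SemidirectProduct.mul_left, hx, map_one, MulAut.one_apply, toAdd_mul, Pi.add_apply]

/-- **The lattice carries two independent characters** (coordinates `0` and `1`, `p ≥ 2`): `vb₁(Γ_p) ≥ 2`. [folklore] -/
theorem exists_indep_ker [Fact p.Prime] : ∃ (ψ₀ ψ₁ : (SemidirectProduct.rightHom : Grp p →* Rot p).ker →* Multiplicative ℤ)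
    (a b : (SemidirectProduct.rightHom : Grp p →* Rot p).ker),
      Multiplicative.toAdd (ψ₀ a) * Multiplicative.toAdd (ψ₁ b) ≠ Multiplicative.toAdd (ψ₁ a) * Multiplicative.toAdd (ψ₀ b) := by
  haveI : NeZero p := ⟨(Fact.out : p.Prime).ne_zero⟩
  have h01 : (0 : ZMod p) ≠ 1 := by
    haveI : Fact (1 < p) := ⟨(Fact.out : p.Prime).one_lt⟩
    exact zero_ne_one
  obtain ⟨ψ₀, h0⟩ := exists_coord_hom (p := p) 0
  obtain ⟨ψ₁, h1⟩ := exists_coord_hom (p := p) 1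
  let e : ZMod p → Grp p := fun i => SemidirectProduct.inl (Multiplicative.ofAdd (Pi.single i (1 : ℤ)))
  have he : ∀ i, e i ∈ (SemidirectProduct.rightHom : Grp p →* Rot p).ker := fun i => by
    rw [MonoidHom.mem_ker, SemidirectProduct.rightHom_inl]
  refine ⟨ψ₀, ψ₁, ⟨e 0, he 0⟩, ⟨e 1, he 1⟩, ?_⟩
  rw [h0, h1, h0, h1]
  simp only [e, SemidirectProduct.left_inl, toAdd_ofAdd, Pi.single_eq_same, Pi.single_eq_of_ne h01, Pi.single_eq_of_ne h01.symm]
  norm_num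

/-- **THE INPUT EXISTS, with `p` orbit representatives: every Cayley graph of `Γ_p` carries an end-state datum** (gen 27's `EndStateCayley.exists_input_of_vb1`
on the lattice). [cite: BenjaminiSchramm1996, §2 (Cayley graphs)] [cite: GrimmettLi2017Amenability, Prop. 18] -/
theorem exists_endState_input [Fact p.Prime] (S : Finset (Grp p)) :
    ∃ (A₀ : Subgroup (mulCayley (↑S : Set (Grp p)) ≃g mulCayley (↑S : Set (Grp p)))) (reps : Finset (Grp p)) (c : A₀ →* Multiplicative (Site 2)),
      (∀ w : Grp p, ∃ x : A₀, ∃ s ∈ reps, (x : mulCayley (↑S : Set (Grp p)) ≃g mulCayley (↑S : Set (Grp p))) s = w) ∧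
      (∀ (x : A₀) (w : Grp p), (x : mulCayley (↑S : Set (Grp p)) ≃g mulCayley (↑S : Set (Grp p))) w = w → c x = 1) ∧
      ∃ x y : A₀, MaxArea.det2 (Multiplicative.toAdd (c x)) (Multiplicative.toAdd (c y)) ≠ 0 := by
  haveI : NeZero p := ⟨(Fact.out : p.Prime).ne_zero⟩
  haveI : (SemidirectProduct.rightHom : Grp p →* Rot p).ker.FiniteIndex := ⟨by rw [index_ker]; exact (Fact.out : p.Prime).ne_zero⟩
  obtain ⟨ψ₀, ψ₁, a, b, hind⟩ := exists_indep_ker (p := p)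
  exact EndStateCayley.exists_input_of_vb1 S _ ψ₀ ψ₁ a b hind

/-! ## §6 Graph level: on a GRR of `Γ_p` every end-state datum has at least `p` types -/

/-- **THEOREM (at least `p` types).**  Let `X = Cay(Γ_p; S)` be a Cayley graph all of whose automorphisms are left translations (a graphical regular
representation).  Then EVERY subgroup `A ≤ Aut(X)` with a `ℤ²`-character of rank two and a finite set `reps` of orbit representatives has `p ≤ |reps|` —
an end-state datum on `X` has at least `p` vertex orbits.  (GRRs of `Γ_p` exist by Leemann–de la Salle's classification, Cor. 1.2: `Γ_p` is neither abelian nor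
generalised dicyclic — R-level, NOT used: the GRR property is a hypothesis here.)
[cite: BenjaminiSchramm1996, Conj. 4; §2 (Cayley graphs)] [cite: LeemannDelasalle2022, Cor. 1.2] -/
theorem le_card_reps_of_grr [Fact p.Prime] (S : Set (Grp p))
    (hGRR : ∀ α : mulCayley S ≃g mulCayley S, ∀ v : Grp p, α v = α 1 * v)
    (A : Subgroup (mulCayley S ≃g mulCayley S)) (reps : Finset (Grp p)) (cA : A →* Multiplicative (Site 2))
    (horb : ∀ w : Grp p, ∃ x : A, ∃ s ∈ reps, (x : mulCayley S ≃g mulCayley S) s = w)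
    (hrank : ∃ x y : A, MaxArea.det2 (Multiplicative.toAdd (cA x)) (Multiplicative.toAdd (cA y)) ≠ 0) : p ≤ reps.card := by
  haveI : NeZero p := ⟨(Fact.out : p.Prime).ne_zero⟩
  -- evaluation at `1` is an injective homomorphism `A → Γ_p`
  let ev : A →* Grp p :=
    { toFun := fun x => (x : mulCayley S ≃g mulCayley S) 1
      map_one' := rfl
      map_mul' := fun x y => by
        show ((x : mulCayley S ≃g mulCayley S) * (y : mulCayley S ≃g mulCayley S)) 1 = _
        rw [RelIso.coe_mul, Function.comp_apply, hGRR (x : mulCayley S ≃g mulCayley S) ((y : mulCayley S ≃g mulCayley S) 1)] }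
  have hev : ∀ x : A, ev x = (x : mulCayley S ≃g mulCayley S) 1 := fun x => rfl
  have hinj : Function.Injective ev := by
    intro x y hxy
    apply Subtype.ext
    apply RelIso.ext
    intro v
    rw [hGRR (x : mulCayley S ≃g mulCayley S) v, hGRR (y : mulCayley S ≃g mulCayley S) v, ← hev, ← hev, hxy]
  -- transport the character to the image
  let e : A ≃* ev.range := MonoidHom.ofInjective hinj
  let c : ev.range →* Multiplicative (Site 2) := cA.comp e.symm.toMonoidHom
  have hc : ∀ x : A, c (e x) = cA x := fun x => by
    show cA (e.symm (e x)) = cA x; rw [MulEquiv.symm_apply_apply]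
  have hrank' : ∃ x y : ev.range, MaxArea.det2 (Multiplicative.toAdd (c x)) (Multiplicative.toAdd (c y)) ≠ 0 := by
    obtain ⟨x, y, hxy⟩ := hrank
    exact ⟨e x, e y, by rwa [hc, hc]⟩
  have hdvd := dvd_index ev.range c hrank'
  -- the inverted representatives hit every left coset of the image
  have hsurj : Function.Surjective (fun s : reps => (QuotientGroup.mk ((s : Grp p)⁻¹) : Grp p ⧸ ev.range)) := by
    intro q
    induction q using QuotientGroup.induction_on with
    | H g =>
      obtain ⟨x, s, hs, hxs⟩ := horb g⁻¹
      refine ⟨⟨s, hs⟩, ?_⟩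
      apply QuotientGroup.eq.2
      rw [inv_inv]
      have hxs' : ev x * s = g⁻¹ := by rw [hev, ← hGRR]; exact hxs
      have hsg : s * g = (ev x)⁻¹ := by
        have h := congrArg (fun z : Grp p => z⁻¹) hxs'
        simp only [inv_inv] at h
        rw [← h, mul_inv_rev, mul_inv_cancel_left]
      rw [hsg]
      exact inv_mem ⟨x, rfl⟩
  haveI : Finite (Grp p ⧸ ev.range) := Finite.of_surjective _ hsurj
  have hidx : Nat.card (Grp p ⧸ ev.range) ≤ reps.card := by
    have h := Nat.card_le_card_of_surjective _ hsurj
    rwa [Nat.card_eq_finsetCard] at h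
  have hne : Nat.card (Grp p ⧸ ev.range) ≠ 0 := (Nat.card_pos (α := Grp p ⧸ ev.range)).ne'
  exact (Nat.le_of_dvd (Nat.pos_of_ne_zero hne) hdvd).trans hidx

end ZWr

end Summit.CriticalPhenomena.PercolationContinuityZ3.Theorems.Transplant

end
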